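import Summits.Ventures.AbcSig.Recipes.FreyTraceLemma42

/-!
# Venture AbcSig — `BS04Package` decomposed: existence (cited) ∧ level divisibility (cited) ∧ trace package (cited) ⇒ `BS04Package`

HONEST FRAMING. Interface + glue file of the COMPUTATION cell `pub-abcsig`; no Diophantine equation is solved and nothing is a claim on
ABC or any summit. TWO named hypotheses are introduced, both CITED and both WEAKER-GRAINED restatements of inputs the cell already
assumes inside `NewformModel.BS04Package`: `BS04ExistencePackage` (= its clause (1), [BS04, Lemma 3.3]) and `LevelDividesPackage`
(Carayol–Livné: the conductor of `ρ̄_{f,ν}` divides the level; with [BS04, Lemma 2.1/3.2] at the ODD primes — only the odd part of the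
Serre level is asserted to divide `N`, so the statement is independent of the cell's erratum E3 on the `2`-part). Together with `FreyTracePackage`
(`Recipes/FreyTracePackage.lean`) they IMPLY `BS04Package` (`bs04Package_of_parts`, PROVED) — the [BS04, Lemma 4.2] content of its
clause (2) being a theorem (`Recipes/FreyTraceLemma42.lean`). So every row of the cell taking `(hP : M.BS04Package)` can be fed
`bs04Package_of_parts h₁ h₂ h₃` unchanged, and the Kraus tables come for free at any level, in both shapes the cell uses: integer traces at the auxiliary primes
(`arisesMod_krausTableAt_of_parts`) and residues modulo `n` (`krausTableModAt`, `arisesMod_krausTableModAt_of_parts` — the shape of the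
generated module-M4 files' `RefinedTraces (family) (m4cTab… m)` hypotheses).

References: [BS04] Bennett–Skinner, Canad. J. Math. 56 (2004), Lemma 3.2, Lemma 3.3, (3.1), Lemma 4.2; H. Carayol, Duke Math. J. 59
(1989) 785–801; R. Livné, J. Number Theory 31 (1989) 133–141.
-/

namespace Summit.Ventures.AbcSig

/-! ## The two remaining cited inputs, as named hypotheses -/

/-- **NAMED HYPOTHESIS (CITED) — clause (1) of `BS04Package` alone: [BS04, Lemma 3.3], generic branch `n ∤ ABC`.** "Suppose that
`n ≥ 7` is a prime and that `ρ^E_n` is associated to a primitive solution `(a, b, c)` to (1.2) with `ab ≠ ±1`. Put `N_n(E) = N_n^E`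
(`n ∤ ABC`) … The representation `ρ^E_n` arises from a cuspidal newform of weight 2, level `N_n(E)`, and trivial Nebentypus character"
(p. 31; proof: modularity [BCDT], [BS04, Cor. 3.1], Ribet's level lowering). In the interface: for a standing datum in case `κ` there is
a newform `f` of level `bs04Level κ A B C n` with `M.Arises S N f` (stated for every `N` equal to that level). Printed caveat at `n = 7`
(Bennett–Vatsal–Yazdani 2004 on Cor. 3.1) carried as for `BS04Package`. CITED, never proved here. -/
def NewformModel.BS04ExistencePackage (M : NewformModel) : Prop :=
  ∀ (S : FreyDatum) (κ : FreyCase), Standing S κ →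
    ∀ N : ℕ, bs04Level κ S.A S.B S.C S.n = N → ∃ f : M.Form N, M.Arises S N f

/-- **NAMED HYPOTHESIS (CITED) — the level is divisible by the ODD PART of the Serre level.** If `ρ^E_n` (standing datum, case `κ`)
arises from a newform `f` of level `N`, then `bs04OddLevel A B C n ∣ N`. Printed inputs: the conductor of the mod-`ν` representation of a
newform divides its level — H. Carayol, *Sur les représentations galoisiennes modulo ℓ attachées aux formes modulaires*, Duke Math. J. 59
(1989) 785–801, and R. Livné, *On the conductors of mod ℓ Galois representations coming from modular forms*, J. Number Theory 31 (1989)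
133–141 (`N(ρ̄_{f,ν}) ∣ N_f`); and, at the ODD primes, [BS04, Lemma 2.1(b), (d) + Lemma 3.2]: the Frey curve has multiplicative
reduction at the odd primes `q ∣ AB` with `n ∤ ord_q Δ` (`A, B` `n`-th-power free) and additive reduction at the odd `p ∣ C` with inertia
of order prime to `n`, so the odd part of `N(ρ^E_n)` is `∏_{p ∣ C, p odd, p ≠ n} p² ∏_{q ∣ AB, q odd, q ≠ n} q = bs04OddLevel A B C n`.
DELIBERATELY ONLY THE ODD PART: the `2`-part of the printed level [BS04, Lemma 3.2] needs the cell's erratum E3 in the sub-class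
`ord₂ B = 6`, `b` even of case (v) (referee/E3-LEVEL-LEMMA.md, `Recipes/E3Package.lean`), and nothing downstream uses it — the trace
package concerns odd primes only. In the intended model `Arises S N f` identifies `ρ̄_{f,ν}` with `ρ^E_n ⊗ 𝔽̄_n`, whence the divisibility.
It supplies the antecedent of `FreyTracePackage` at an arbitrary level `N` (clause (2) of `BS04Package` quantifies over all levels); rows
that work at the Serre level itself do not need it (`FreyTracePackage.arisesMod_bs04Allowed_level`). CITED, never proved here. -/
def NewformModel.LevelDividesPackage (M : NewformModel) : Prop :=
  ∀ (S : FreyDatum) (κ : FreyCase), Standing S κ →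
    ∀ (N : ℕ) (f : M.Form N), M.Arises S N f → bs04OddLevel S.A S.B S.C S.n ∣ N

/-! ## `BS04Package` from its primitive parts -/

/-- **`BS04Package` DECOMPOSED.** The cell's single named hypothesis `NewformModel.BS04Package` ([BS04, Lemma 3.3 + (3.1) + Lemma 4.2])
follows from three primitive cited packages: existence of the newform (`BS04ExistencePackage`, Lemma 3.3), divisibility of the level
by the odd part of the Serre level (`LevelDividesPackage`, Carayol–Livné + Lemma 2.1/3.2 at odd primes), and the trace package (`FreyTracePackage`, (3.1) + the Frey
curves) — the content of [BS04, Lemma 4.2] in clause (2) being now PROVED (`freyTrace_mem_bs04Allowed`, Hasse + `2`-torsion). Every row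
theorem of the cell taking `(hP : M.BS04Package)` can therefore be instantiated with `bs04Package_of_parts h₁ h₂ h₃` unchanged. -/
theorem NewformModel.bs04Package_of_parts (M : NewformModel) (h₁ : M.BS04ExistencePackage) (h₂ : M.LevelDividesPackage)
    (h₃ : M.FreyTracePackage) : M.BS04Package := by
  intro S κ hA hB hC hsq hprime h7 hndvd hfree hsol hab1 hab2 hcase
  have hS : Standing S κ := ⟨hA, hB, hC, hsq, hprime, h7, hndvd, hfree, hsol, hab1, hab2, hcase⟩
  exact ⟨h₁ S κ hS, fun N f hf => h₃.arisesMod_bs04Allowed S κ hS N (h₂ S κ hS N f hf) f hf⟩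

/-- … and with Kraus's refinement thrown in: under the three primitive packages, at ANY level from which `ρ^E_n` arises and for ANY
list of auxiliary primes, `M.ArisesMod f n (krausTableAt κ.model A B C n aux)`. -/
theorem NewformModel.arisesMod_krausTableAt_of_parts (M : NewformModel) (h₂ : M.LevelDividesPackage) (h₃ : M.FreyTracePackage)
    (S : FreyDatum) (κ : FreyCase) (hS : Standing S κ) (N : ℕ) (f : M.Form N) (hf : M.Arises S N f) (aux : List ℕ) :
    M.ArisesMod f S.n (krausTableAt κ.model S.A S.B S.C S.n aux) :=
  h₃.arisesMod_krausTableAt S κ hS N (h₂ S κ hS N f hf) f hf aux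

/-- Conversely, `BS04Package` contains the existence package (its clause (1)). (It does NOT contain `LevelDividesPackage` or
`FreyTracePackage`, which are finer than its clause (2).) -/
theorem NewformModel.BS04Package.existencePackage {M : NewformModel} (hP : M.BS04Package) : M.BS04ExistencePackage := by
  intro S κ hS N hN
  obtain ⟨hA, hB, hC, hsq, hprime, h7, hndvd, hfree, hsol, hab1, hab2, hcase⟩ := hS
  exact (hP S κ hA hB hC hsq hprime h7 hndvd hfree hsol hab1 hab2 hcase).1 N hN

/-- **The standing-data form of the rows' Kraus-table hypothesis from the parts.** For a family `fam` all of whose members with a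
solution are standing data in case `κ` — the shape in which `Rows/TemplateKraus.lean` consumes `RefinedTraces` after its
normalisations — the three primitive packages give `M.ArisesMod f n (krausTableAt κ.model A B C n aux)` for every `f` from which
`ρ^E_n` arises. Recorded as the implication on single data; quantifying over a family is left to the templates. -/
theorem NewformModel.refinedTraces_pointwise_of_parts (M : NewformModel) (h₂ : M.LevelDividesPackage) (h₃ : M.FreyTracePackage)
    (S : FreyDatum) (κ : FreyCase) (hS : Standing S κ) (aux : List ℕ) :
    ∀ (N : ℕ) (f : M.Form N), M.Arises S N f → M.ArisesMod f S.n (krausTableAt κ.model S.A S.B S.C S.n aux) :=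
  fun N f hf => M.arisesMod_krausTableAt_of_parts h₂ h₃ S κ hS N f hf aux

/-! ## The module-M4 shape: residues modulo `n` at the auxiliary primes -/

/-- The Kraus table REDUCED MODULO `n` at the auxiliary primes (`krausTableMod`, the shape of the cell's module-M4 tables `m4cTab…` /
`krausTab_*` and of the certificates' `S_q_mod_n`), `bs04Allowed` elsewhere. -/
def krausTableModAt (μ : FreyModel) (A B C n : ℕ) (aux : List ℕ) (q : ℕ) : List ℤ :=
  if q ∈ aux then krausTableMod μ A B C n q else bs04Allowed q

/-- Membership in the mod-`n` fold: residues of members are members. -/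
theorem mem_foldl_insertSorted_emod {n : ℤ} {x : ℤ} (l acc : List ℤ) (h : (∃ t ∈ l, t % n = x) ∨ x ∈ acc) :
    x ∈ l.foldl (fun acc t => insertSorted (t % n) acc) acc := by
  induction l generalizing acc with
  | nil =>
    rcases h with ⟨t, ht, -⟩ | h
    · simp at ht
    · simpa using h
  | cons s rest ih =>
    simp only [List.foldl_cons]
    apply ih
    rcases h with ⟨t, ht, htx⟩ | h
    · rcases List.mem_cons.mp ht with rfl | ht
      · exact Or.inr (Conjectures.mem_insertSorted.mpr (Or.inl htx.symm))
      · exact Or.inl ⟨t, ht, htx⟩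
    · exact Or.inr (Conjectures.mem_insertSorted.mpr (Or.inr h))

/-- The residue mod `n` of an entry of the Kraus table is an entry of the mod-`n` table. -/
theorem emod_mem_krausTableMod {μ : FreyModel} {A B C n q : ℕ} {t : ℤ} (ht : t ∈ krausTable μ A B C n q) :
    t % (n : ℤ) ∈ krausTableMod μ A B C n q := by
  unfold krausTableMod
  exact mem_foldl_insertSorted_emod _ _ (Or.inl ⟨t, ht, rfl⟩)

/-- In characteristic `n`, an integer and its residue mod `n` have the same image. -/
theorem intCast_emod_eq_of_charP (k : Type) [Field k] (n : ℕ) [CharP k n] (t : ℤ) : ((t % (n : ℤ) : ℤ) : k) = (t : k) :=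
  (CharP.intCast_eq_intCast k n).mpr (Int.mod_modEq t n)

/-- **The module-M4 table hypothesis, DERIVED (standing form).** Under the trace package, for a standing datum in case `κ`, a level `N`
divisible by the odd part of the Serre level and `M.Arises S N f`: `M.ArisesMod f n (krausTableModAt κ.model A B C n aux)` for ANY list of
auxiliary primes — the shape `RefinedTraces (family) (m4cTab… m)` in which the cell's generated module-M4 files (`Levels/N…M4C…K….lean`)
take Kraus's refinement, for standing data. -/
theorem NewformModel.FreyTracePackage.arisesMod_krausTableModAt {M : NewformModel} (hT : M.FreyTracePackage)
    (S : FreyDatum) (κ : FreyCase) (hS : Standing S κ) (N : ℕ) (hdiv : bs04OddLevel S.A S.B S.C S.n ∣ N) (f : M.Form N)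
    (hf : M.Arises S N f) (aux : List ℕ) : M.ArisesMod f S.n (krausTableModAt κ.model S.A S.B S.C S.n aux) := by
  obtain ⟨k, hk, hchar, ψ, hψ⟩ := hT.arisesMod_krausTableAt S κ hS N hdiv f hf aux
  refine ⟨k, hk, hchar, ψ, fun q hq hq2 hqn hqN => ?_⟩
  obtain ⟨t, ht, hψt⟩ := hψ q hq hq2 hqn hqN
  unfold krausTableAt at ht
  unfold krausTableModAt
  split_ifs at ht ⊢ with hmem
  · exact ⟨t % (S.n : ℤ), emod_mem_krausTableMod ht, by rw [hψt, intCast_emod_eq_of_charP k S.n t]⟩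
  · exact ⟨t, ht, hψt⟩

/-- … and from the three primitive packages at ANY level. -/
theorem NewformModel.arisesMod_krausTableModAt_of_parts (M : NewformModel) (h₂ : M.LevelDividesPackage) (h₃ : M.FreyTracePackage)
    (S : FreyDatum) (κ : FreyCase) (hS : Standing S κ) (N : ℕ) (f : M.Form N) (hf : M.Arises S N f) (aux : List ℕ) :
    M.ArisesMod f S.n (krausTableModAt κ.model S.A S.B S.C S.n aux) :=
  h₃.arisesMod_krausTableModAt S κ hS N (h₂ S κ hS N f hf) f hf aux

end Summit.Ventures.AbcSig
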